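import Summits.CriticalPhenomena.PercolationContinuityZ3.Theorems.PercNearOneGluingNoHeavyLowerTailFrontierDecRowsPinnedEdgeAllMarkings
import Summits.CriticalPhenomena.PercolationContinuityZ3.Theorems.PercNearOneGluingNoHeavyLowerTailFrontierDecRowsUnmarkedEdgeKey
import HarnessLib

/-!
# KEY with the full induction hypotheses: `K ≥ 0` at one terminal, given `E₃ ≥ 0` at ALL injective markings, closes a pinned row

Support file (prover seat `prim-l12-p6`, gen 4; `--supports stmt-CriticalPhenomena-4575`).  No named facts, no sorries, no `native_decide`; one bookkeeping definition
`KeyHypAtAll` (= bnk-1 gen 9's `KeyHypAt` with the all-markings induction hypotheses of `…PinnedEdgeAllMarkings`).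
This is the "richer IH package in KeyHypAt (other markings)" of prim-bnk-1's gen-9 HANDOFF (re-seat trigger (ii)): when certifying the single cubic `K = 3B₁ − 2B₀ ≥ 0`
at the edge `(x i₀, u)`, the rows `E₃(E₁ x', E₂ x', E₃ x') ≥ 0` under `w[e↦0]` AND `w[e↦1]` are admissible for EVERY injective marking `x'` (for four terminals and the
five-point law: the row read at all 120 injective markings of `{a,b,c,y,u}`, both laws).
* `KeyHypAtAll i₀ E₁ E₂ E₃`; `unmarkedEdgeHypAtAll_of_keyHypAtAll` (decreasing families; bnk-1's `polar₁_nonneg_of_key`, `polar₁_swap_nonneg_of_key`, `pivotal_prod_nonneg`);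
* `sahiE3_sep_nonneg_of_keyHypAtAll` — three group separations, the single terminal `i₀` one of the six sides: `(∀ m, KeyHypAtAll i₀ …) → 0 ≤ E₃` at every injective marking
  of every finite weighted graph;  `frontier_36_all_of_keyAtAll (i₀ : Fin 4)` — PATH, all markings, any one terminal.
-/

noncomputable section

namespace Summit.CriticalPhenomena.PercolationContinuityZ3.Theorems

namespace TerminalEdgeInduction

open MeasureTheory Literature.Probability.Percolation Literature.Probability.LatticeModels
open EdgeInduction CovTransferCert E3GroupSepCert
open scoped Classical

variable {n k : ℕ}

/-- **KEY hypotheses at the terminal `i₀` with ALL-MARKINGS induction hypotheses**: for every `w`, injective `x`, unmarked `u`, `e = s(x i₀, u)`: IF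
`0 ≤ E₃(E₁ x', E₂ x', E₃ x')` under `w[e↦0]` and under `w[e↦1]` for EVERY injective `x'`, THEN `0 ≤ key μ_{w[e↦0]} μ_{w[e↦1]} (E₁ x) (E₂ x) (E₃ x)`. [this work] -/
def KeyHypAtAll (i₀ : Fin k) (E₁ E₂ E₃ : (Fin k → Fin n) → Set (BondConfig (Fin n))) : Prop :=
  ∀ (w : Sym2 (Fin n) → unitInterval) (x : Fin k → Fin n), Function.Injective x → ∀ (u : Fin n), (∀ j, x j ≠ u) →
    (∀ x' : Fin k → Fin n, Function.Injective x' →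
        0 ≤ sahiE3 (prodBernoulli (Function.update w s(x i₀, u) 0)) (E₁ x') (E₂ x') (E₃ x') ∧
        0 ≤ sahiE3 (prodBernoulli (Function.update w s(x i₀, u) 1)) (E₁ x') (E₂ x') (E₃ x')) →
    0 ≤ key (prodBernoulli (Function.update w s(x i₀, u) 0)) (prodBernoulli (Function.update w s(x i₀, u) 1)) (E₁ x) (E₂ x) (E₃ x)

variable {E₁ E₂ E₃ : (Fin k → Fin n) → Set (BondConfig (Fin n))}

/-- `KeyHypAt i₀` (same-marking IH) implies `KeyHypAtAll i₀`. [this work] -/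
theorem KeyHypAt.toAll {i₀ : Fin k} (h : KeyHypAt i₀ E₁ E₂ E₃) : KeyHypAtAll i₀ E₁ E₂ E₃ :=
  fun w x hx u hu IH => h w x hx u hu (IH x hx).1 (IH x hx).2

/-- **KEY (all-markings IH) ⇒ the unmarked-edge hypotheses (all-markings IH)**, for decreasing families. [this work] -/
theorem unmarkedEdgeHypAtAll_of_keyHypAtAll {i₀ : Fin k} (hE₁ : ∀ x, IsLowerSet (E₁ x)) (hE₂ : ∀ x, IsLowerSet (E₂ x))
    (hE₃ : ∀ x, IsLowerSet (E₃ x)) (h : KeyHypAtAll i₀ E₁ E₂ E₃) : UnmarkedEdgeHypAtAll i₀ E₁ E₂ E₃ := by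
  intro w x hx u hu IH
  have hK := h w x hx u hu IH
  exact ⟨polar₁_nonneg_of_key (IH x hx).1 hK,
    polar₁_swap_nonneg_of_key (IH x hx).1 (IH x hx).2 hK (pivotal_prod_nonneg w s(x i₀, u) (hE₁ x) (hE₂ x) (hE₃ x))⟩

/-- **Group separations pinned at one terminal, from KEY with all-markings induction hypotheses.** [this work] -/
theorem sahiE3_sep_nonneg_of_keyHypAtAll (i₀ : Fin k) (I₁ J₁ I₂ J₂ I₃ J₃ : List (Fin k))
    (hpin : I₁ = [i₀] ∨ J₁ = [i₀] ∨ I₂ = [i₀] ∨ J₂ = [i₀] ∨ I₃ = [i₀] ∨ J₃ = [i₀])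
    (h : ∀ m : ℕ, KeyHypAtAll i₀ (fun x : Fin k → Fin m => connEvent (sep (I₁.map x) (J₁.map x)))
      (fun x => connEvent (sep (I₂.map x) (J₂.map x))) (fun x => connEvent (sep (I₃.map x) (J₃.map x))))
    (w : Sym2 (Fin n) → unitInterval) (x : Fin k → Fin n) (hx : Function.Injective x) :
    0 ≤ sahiE3 (prodBernoulli w) (connEvent (sep (I₁.map x) (J₁.map x))) (connEvent (sep (I₂.map x) (J₂.map x)))
      (connEvent (sep (I₃.map x) (J₃.map x))) :=
  sahiE3_sep_nonneg_of_unmarkedEdgeHypAtAll i₀ I₁ J₁ I₂ J₂ I₃ J₃ hpin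
    (fun m => unmarkedEdgeHypAtAll_of_keyHypAtAll (fun _ => isLowerSet_connEvent_sep _ _) (fun _ => isLowerSet_connEvent_sep _ _)
      (fun _ => isLowerSet_connEvent_sep _ _) (h m)) w x hx

/-- **PATH (row 36) on every finite weighted graph from `K ≥ 0` at ANY ONE terminal, certified with the all-markings induction hypotheses.** [this work] -/
theorem frontier_36_all_of_keyAtAll (i₀ : Fin 4)
    (h : ∀ m : ℕ, KeyHypAtAll i₀ (fun x : Fin 4 → Fin m => connEvent (FrontierDecRows.row 36 m (x 0, x 1, x 2, x 3)).1)
      (fun x => connEvent (FrontierDecRows.row 36 m (x 0, x 1, x 2, x 3)).2.1)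
      (fun x => connEvent (FrontierDecRows.row 36 m (x 0, x 1, x 2, x 3)).2.2))
    (w : Sym2 (Fin n) → unitInterval) (a b c y : Fin n) :
    0 ≤ sahiE3 (prodBernoulli w) (connEvent (FrontierDecRows.row 36 n (a, b, c, y)).1)
      (connEvent (FrontierDecRows.row 36 n (a, b, c, y)).2.1) (connEvent (FrontierDecRows.row 36 n (a, b, c, y)).2.2) :=
  frontier_36_all_of_atAll i₀ (fun m => unmarkedEdgeHypAtAll_of_keyHypAtAll (fun x => (isLowerSet_row 36 x).1)
    (fun x => (isLowerSet_row 36 x).2.1) (fun x => (isLowerSet_row 36 x).2.2) (h m)) w a b c y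

end TerminalEdgeInduction

end Summit.CriticalPhenomena.PercolationContinuityZ3.Theorems
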